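/-
Copyright: lit-balaban cell, Phase-2 proof seat p33 (gen 12).  Statement-level skeleton of a published paper; no proof claims beyond
what the kernel checks below.
-/
import Literature.MathematicalPhysics.QuantumFieldTheory.BalabanImbrieJaffe1984to88.BIJ85SmoothGaugeRegular17

/-!
# `BalabanImbrieJaffe1984to88.BIJ85RegionPropagatorsActualBg` — T. Bałaban, J. Imbrie, A. Jaffe, *Renormalization of the Higgs model:
minimizers, propagators and the stability of mean field theory*, Commun. Math. Phys. **97** (1985) 299–329 [BalabanImbrieJaffe1985],
Sect. 7.3 p. 326 [PDF 28], with [7] = T. Bałaban, *Regularity and decay of lattice Green's functions*, Commun. Math. Phys. **89** (1983)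
571–597 [Balaban1983RegularityDecay], (1.3)–(1.8) pp. 572–573 and the gauge reductions pp. 580–581: **[7]'s REGION OPERATORS
`−Δ^{η,N}_{u_k,Ω} + a_kP_k(u_k)` AND GREEN'S FUNCTIONS `G_k(Ω, u_k)` AT THE ACTUAL BACKGROUND `u_k` ON LOCAL REGIONS ARE GAUGE-CHOICE-FREE,
AND (1.8), (1.10) HOLD FOR THEM** — file 4 after `BIJ85SmoothPotential326` / `BIJ85LocalSmoothGauge326` / `BIJ85SmoothGaugeRegular17`.

statement-level skeleton of published theorems with citation tags; proofs where landed; nothing here is a claim about the Yang–Mills mass gap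

PDFs held: `paper:balaban1985-cmp97-bij-higgs-minimizers` (journal page = PDF page + 298), p. 326 [PDF 28] re-read this session (text
layer); `paper:balaban1983-cmp89-regularity-decay` (journal page = PDF page + 570), pp. 572–573, 580–581.

CITATION HEADER (lean-in-tree rule).  Phase-2 file of the lit-balaban TYPED SKELETON (HOME `run/shared/lean/pub/lit-balaban/`), seat p33
gen 12 (unit `lit-balaban-p33-g12`; TAKING line HOME/STATUS.md 2026-08-22T07:14Z); SKELETON row **C1.Eq7.3.1-7.3.2** (owner r15, referee
ref-5) × **B4.Claim@573(1.8)** / **B4.Thm@573** (1.10) (owner r01); HOME/GAPS.md G-C1-05 ADDENDUM 9 «WHAT REMAINS (a)», the sub-item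
*gauge covariance by λ on the box*.  THE PRINTED TEXTS, verbatim.  [BalabanImbrieJaffe1985] p. 326: *"The propagators arising from
Δ_k(u_k), under the restriction (7.3.1) on the gauge field, also satisfy the regularity and decay estimates of [7]. In order to remain within
the framework of this reference, we remark that by change of gauge u_k can be transformed in a local region Λ into a configuration of the
form exp[ie_kηA], where A is smooth and small."*  [7] p. 572: *"⟨φ, (−Δ^{η,N}_{A,Ω})φ⟩ = Σ_{b⊂Ω} η^d |η^{−1}(U(A_b)φ(b₊) − φ(b₋))|² (1.3)
… (Q_k(A)φ)(y) = Σ_{x∈B^k(y)} η^d U(A(Γ^{(k)}_{y,x}))φ(x) (1.4) … P_k(A) = Q_k^*(A)Q_k(A) (1.5) … G_k(Ω, A) = (−Δ^{η,N}_{A,Ω} + m² +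
aP_k(A))^{−1} (1.6)"*; p. 573: *"there exists a positive constant γ₀ such that for e sufficiently small and for a regular vector field A
−Δ^{η,N}_{A,Ω} + aP_k(A) ≥ γ₀I. (1.8) The constant γ₀ is independent of the lattice spacing η, as well as of Ω and of A."*; p. 580–581:
*"Using the same gauge transformation as in the proof of Lemma 2.4, we reduce them to the case A₀ = 0."* / *"… is equivalent to the case of
configuration A₀ = 0 by the same argument with the gauge transformation as before."*

THE POINT OF THIS FILE.  [7]'s operators (1.3)–(1.6) read the vector field `A` ONLY through the link variables `U(A_b) = e^{qeηA_b}` on the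
bonds of `Ω` (r01's `B4GaugeCovariance.b4Op`, `fieldLink`), and for the abelian Higgs representation (`N = 2`, rotation flow) `e^{qθ}` is
the rotation by the angle `θ`, determined by the unit complex number `e^{iθ}`.  Hence for a `U(1)` lattice gauge field `u` on the η-torus
and a region `Ω` of [7]'s lattice charted into a non-wrapping box `Λ`, [7]'s operator **AT THE BACKGROUND `u`** is `H(Ω, u) :=`
r01's `regionOp rot e … Ω A'` at ANY real bond function `A'` with `e^{ieηA'_b} = u_b` on the bonds of `Ω` (a *logarithm field* of `u`;
the principal one `A'_b = (eη)^{−1}arg u_b` always exists) — and this operator does not depend on the logarithm (§3).  Files 1–3 of this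
seat produced, for the ACTUAL background `u_k` of [BalabanImbrieJaffe1985] (4.5.4) under (7.3.1), the local smooth gauge
`u_k = exp[ie_k(∂λ + ηA)]` on `Λ` with `A` regular in the sense of (1.7), and COMPOSED r01's hypothesis-free (1.8) and (1.10) at THIS `A`
(`BIJ85SmoothGaugeRegular17`, HONEST SCOPE (i): *"gauge covariance under λ … is NOT made here"*).  Here the gauge covariance is made:
`H(Ω, u_k) = 𝒢_λ H(Ω, A) 𝒢_λᵀ` with the block-diagonal orthogonal `𝒢_λ = ⊕_x R(−e_kλ(x))` (r01's `b4Op_bondGauge` + a link-variable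
congruence), so **(1.8) holds for `H(Ω, u_k)` with the SAME `γ₀`** although no logarithm field of `u_k` itself need be (1.7)-regular, and
**the value member of (1.10) holds for `G_k(Ω, u_k) = H(Ω, u_k)⁻¹`** (sup norms are rotated sitewise: constant `4c₀`).

WHAT IS PROVED (0 `sorry`, standard axioms; theorems only, no definition, no named fact).
* §1 `b4Op_congr_fieldLink` — [7]'s operator (1.6) depends on `A` only through the link variables on weighted pairs and contour steps;
  `rot_U_eq_of_circleExp_eq` — `e^{is} = e^{it} ⇒ R(s) = R(t)` for the rotation flow.
* §2 `regionOp_gauge` — GAUGE COVARIANCE OF r01's REGION OPERATOR IN COMPONENT FORM: if `U(κA'_ν(x)) = U(κ(A_ν(x) + σ(x) − σ(x + e_ν)))`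
  on the bonds of `Ω` (both ends in `Ω`), then `regionOp F e Ω A' = 𝒢_σ · regionOp F e Ω A · 𝒢_σᵀ`; `regionOp_congr_link` (`σ = 0`).
* §3 `regionOp_logField_eq` — LOGARITHM INDEPENDENCE: two real bond functions with `e^{i(e/n)A'} = u = e^{i(e/n)A''}` on the bonds of `Ω`
  give the same `regionOp rot e Ω ·` (so `H(Ω, u)`, `G_k(Ω, u)` are functions of the `U(1)` field `u` alone); `logField_arg` — the
  principal logarithm `(n/e)·arg u_b` is one.
* §4 (private plumbing) transfer under orthogonal block-diagonal conjugation: forms, inverses (r01's `conj_inv`), sitewise sup bounds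
  (`|R_{ij}| ≤ 1`) and one-block supports.
* §5 **`regionOp_actualBg_conj_allTori`** — for every `d ≥ 1`, odd `L > 1`, `p`, box size `n_Λ`, `a`, `β < 1`, `c > 0` there is `e₁ > 0`
  such that on every torus (`P.d = d + 1`, `P.L = L`), every scale `1 ≤ k ≤ m + K`, every `0 < e ≤ e₁`, every unit field `v` under (7.3.1),
  every non-wrapping box and every finite set `Ω` of unit labels whose blocks sit in the box with one bond of slack, there are `λ`, `A` with
  `u_k = exp[ie(∂λ + ηA)]` on the box bonds, `A` regular (1.7) on `Ω`, AND for EVERY logarithm field `A'` of `u_k` on `Ω`: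
  `regionOp rot e Ω A' = 𝒢_λ · regionOp rot e Ω A · 𝒢_λᵀ`, `𝒢_λ = ⊕_x R(−eλ(x))`.
* §6 **`claim18_region_actualBg_allTori` — (1.8) OF [7] FOR `H(Ω, u_k)`**: `∃ γ₀ e₁ > 0` (independent of the torus, the scale, `Ω` and the
  logarithm) with r01's `lower18 γ₀` for the instance `⟨L^k, Ω, e, A'⟩` at EVERY logarithm field `A'` of `u_k` on `Ω`, under (7.3.1),
  `0 < e ≤ e₁` — in particular at the principal logarithm (`claim18_region_actualBg_arg_allTori`).
* §7 **`thm110_value_region_actualBg_allTori` — THE VALUE MEMBER OF (1.10) FOR `G_k(Ω, u_k)`**: r01's `thm110_value_region_unitBlock` shape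
  (`K₀`-block unions, `8 ∣ K₀`, `δ₀ = 1/K₀`, `R₀ = K₀(d + 3)`, `f` supported in one unit block) with constant `4c₀`, at EVERY logarithm field of
  `u_k` on `Ω`.
HONEST SCOPE.  (i) The operators are [7]'s REGION operators (r01's `regionOp`: Neumann bonds of `Ω`, block averages with the staircase
contours `rstairContour` from the base corners `L^k·y`, `a_k = a·(L^k)^{−(d+1)}` in lattice units, mass `m²`) FED WITH THE BOND VARIABLES OF
`u_k` on a region inside a local box `Λ` — the reading of *"the propagators arising from Δ_k(u_k)"* as [7]'s family `G_k(Ω, ·)` at the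
background `u_k`; the relation of this family to [BalabanImbrieJaffe1985]'s WHOLE-TORUS operator `Δ_k(u_k)` / `G_k(u_k)` of (4.6.2) (p11's
`opT`, this seat's `BIJ85Claim73PropagatorDecay`) — torus versus Neumann region, and the tree's centred block/contour conventions (F3)
versus r01's corner-based staircases — is NOT addressed, nor are [7]'s Hölder/δG members (1.9), (1.11)–(1.12) (HOME/GAPS.md G-C1-05 (a)).
(ii) `U(1)` read as `SO(2)` (r01's `OrthFlow.rot`, `N = 2`); boxes that do not wrap; `e₁` depends on `(d, L, p, n_Λ, β, c)` (and `a` in §6)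
— "for e sufficiently small"; `β < 1` as in file 3.  (iii) Constants: `γ₀` of r01's (1.8); `4c₀` in §7 (`|R_{ij}| ≤ 1` twice), not optimised.
Unit `lit-balaban-p33` (literature-prover-lit-balaban-p33-g12-0), 2026-08-22.  NOT summit progress.
-/

open scoped BigOperators

namespace Literature.MathematicalPhysics.QuantumFieldTheory.BalabanImbrieJaffe1984to88.BIJ85RegionPropagatorsActualBg

open Balaban1983to89 hiding Site Plaq
open Balaban1983to89.LatticeFieldCalculus
open Balaban1983to89.T4AxialGaugeSmallField (castSite castSite_apply castSite_add_e boxBonds)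
open Balaban1983to89.B7Prop1Explicit (e e_apply)
open BIJ85Sect1Model (U1Field plaq)
open BIJ85Eq454PlaqResidual (actualBg)
open BIJ85SmoothGaugeRegular17 (eta_eq_inv_pow blk_bounds exists_regular17_gauge_allTori regular17_fineDom_of_box
  thm110_value_local_smooth_gauge_allTori)
open Balaban1983to89.B4GaugeCovariance
open Balaban1983to89.B4Lower18 (fineDom mem_fineDom IsBlockUnion)
open Balaban1983to89.B4Lower18Regular (e1 e1_apply_self e1_apply_ne PathRel rot_lipschitz)
open Balaban1983to89.B4Lower18RegularRegion
open Balaban1983to89.B4Reflection242 (nbrs mem_nbrs blk)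
open Balaban1983to89.B4Lemma21Region (regionOp)
open Balaban1983to89.B4WalkRouteRegion (rpos)
open scoped Matrix
-- inside this namespace the bare `Site`/`Plaq` are the `ℤ^d` carriers of the QFT root; the torus ones are renamed:
open Balaban1983to89 renaming Site → TSite, Plaq → TPlaq

noncomputable section

/-! ## §1  [7]'s operator reads `A` only through the link variables; the rotation flow reads an angle only through `e^{iθ}` -/

section Generic

variable {X Y ι : Type*}

/-- **LOCALITY IN THE LINK VARIABLES**: [7]'s operator `−Δ^{η,N}_{A,Ω} + m² + aP_k(A)` (1.6) depends on the vector field `A` only through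
the link variables `U(κA_b)` on the weighted pairs of (1.3) and on the steps of the contours of (1.4).
[cite: Balaban1983RegularityDecay, (1.3)–(1.6) p.572] -/
theorem b4Op_congr_fieldLink [Fintype X] [Fintype Y] [Fintype ι] [DecidableEq X] [DecidableEq ι] (F : OrthFlow ι) (κ : ℝ)
    {c : X → X → ℝ} (m2 a : ℝ) {q : Y → X → ℝ} {emb : Y → X} {Γ : Y → X → List X} {r : X → X → Prop}
    (hc : ∀ x y, c x y ≠ 0 → r x y) (hΓ : ∀ y x, PathRel r (emb y) (Γ y x)) {A A' : X → X → ℝ}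
    (h : ∀ u v, r u v → fieldLink F κ A u v = fieldLink F κ A' u v) :
    b4Op F κ c m2 a q emb Γ A = b4Op F κ c m2 a q emb Γ A' := by
  unfold b4Op
  exact covOp_congr m2 a (fun x y hxy => h x y (hc x y hxy)) fun y x _ => transport_congr h _ _ (hΓ y x)

/-- **THE ROTATION FLOW FACTORS THROUGH THE CIRCLE**: `e^{is} = e^{it}` in `U(1)` implies `R(s) = R(t)` in `SO(2)` — [7]'s link variable
`e^{qeηA_b}` (1.2) for the abelian Higgs representation is a function of the `U(1)` bond variable `e^{ieηA_b}`.
[cite: Balaban1983RegularityDecay, (1.2) p.572] -/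
theorem rot_U_eq_of_circleExp_eq {s t : ℝ} (h : Circle.exp s = Circle.exp t) : OrthFlow.rot.U s = OrthFlow.rot.U t := by
  obtain ⟨m, hm⟩ := Circle.exp_eq_exp.mp h
  have hc : Real.cos s = Real.cos t := by rw [hm, Real.cos_add_int_mul_two_pi]
  have hs : Real.sin s = Real.sin t := by rw [hm, Real.sin_add_int_mul_two_pi]
  show !![Real.cos s, -Real.sin s; Real.sin s, Real.cos s] = !![Real.cos t, -Real.sin t; Real.sin t, Real.cos t]
  rw [hc, hs]

end Generic

/-! ## §2  Gauge covariance of r01's region operator in component form -/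

section Region

variable {ι : Type*} {d : ℕ}

/-- **LINK VARIABLES OF A GAUGE-RELATED COMPONENT FIELD ON THE BONDS OF A REGION**: if `U(κA'_ν(x)) = U(κ(A_ν(x) + σ(x) − σ(x + e_ν)))`
for every bond `⟨x, x + e_ν⟩` with both ends in `R`, then on every nearest-neighbour pair of `R` (either orientation) the link variables of
`A'` are those of r01's gauge transform `A^σ` (`bondGauge`) of `A`. [cite: Balaban1983RegularityDecay, pp.580–581 «the gauge transformation»] -/
theorem fieldLink_compField_eq_bondGauge [Fintype ι] [DecidableEq ι] (F : OrthFlow ι) (κ : ℝ) {R : Finset (Fin (d + 1) → ℤ)}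
    {Ac Ac' : (Fin (d + 1) → ℤ) → Fin (d + 1) → ℝ} {σ : (Fin (d + 1) → ℤ) → ℝ}
    (hlink : ∀ x ∈ R, ∀ ν : Fin (d + 1), x + e1 ν ∈ R → F.U (κ * Ac' x ν) = F.U (κ * (Ac x ν + σ x - σ (x + e1 ν))))
    (u v : ↥R) (huv : v.1 ∈ nbrs u.1) :
    fieldLink F κ (fun u v : ↥R => compField Ac' u.1 v.1) u v
      = fieldLink F κ (bondGauge (fun u : ↥R => σ u.1) fun u v : ↥R => compField Ac u.1 v.1) u v := by
  obtain ⟨i, hi | hi⟩ := mem_nbrs.mp huv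
  · -- `v = u + e_i`
    have hv : v.1 = u.1 + e1 i := hi
    have hmem : u.1 + e1 i ∈ R := hv ▸ v.2
    simp only [fieldLink, bondGauge, hv, compField_add]
    exact hlink u.1 u.2 i hmem
  · -- `v = u − e_i`, i.e. `u = v + e_i`: transpose the relation at `(v, i)`
    have hu : u.1 = v.1 + e1 i := by rw [hi]; simp [e1]
    have hmem : v.1 + e1 i ∈ R := hu ▸ u.2
    simp only [fieldLink, bondGauge, hu, compField_sub]
    have h1 : κ * -Ac' v.1 i = -(κ * Ac' v.1 i) := by ring
    have h2 : κ * (-Ac v.1 i + σ (v.1 + e1 i) - σ v.1) = -(κ * (Ac v.1 i + σ v.1 - σ (v.1 + e1 i))) := by ring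
    rw [h1, h2, ← F.transpose_eq, ← F.transpose_eq, hlink v.1 v.2 i hmem]

/-- the (1.3) bond weights of a region charge nearest-neighbour pairs only. [folklore] -/
private theorem regWt_ne_zero {n : ℕ} {R : Finset (Fin (d + 1) → ℤ)} {x y : ↥R} (h : regWt n R x y ≠ 0) : y.1 ∈ nbrs x.1 := by
  by_contra hxy
  simp [regWt, hxy] at h

/-- **GAUGE COVARIANCE OF [7]'s REGION OPERATOR IN COMPONENT FORM**: if the link variables of `A'` on the bonds of `Ω` are those of the
gauge transform of `A` by `σ` — `U(κA'_ν(x)) = U(κ(A_ν(x) + σ(x) − σ(x + e_ν)))` whenever `x, x + e_ν ∈ Ω`, `κ = e/n` — then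
`−Δ^{η,N}_{A',Ω} + m² + a_kP_k(A') = 𝒢_σ (−Δ^{η,N}_{A,Ω} + m² + a_kP_k(A)) 𝒢_σᵀ` with `𝒢_σ = ⊕_x U(κσ(x))` — p. 580–581 *"we reduce them
… by the same argument with the gauge transformation"*, for r01's `regionOp` (Neumann bonds, staircase contours ending at their target).
[cite: Balaban1983RegularityDecay, pp.580–581; (1.3)–(1.6) p.572] -/
theorem regionOp_gauge [Fintype ι] [DecidableEq ι] (F : OrthFlow ι) (e₀ : ℝ) {n : ℕ} (hn : 1 ≤ n) (a m2 : ℝ)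
    (Ωc : Finset (Fin (d + 1) → ℤ))
    {Ac Ac' : (Fin (d + 1) → ℤ) → Fin (d + 1) → ℝ} {σ : (Fin (d + 1) → ℤ) → ℝ}
    (hlink : ∀ x ∈ fineDom n Ωc, ∀ ν : Fin (d + 1), x + e1 ν ∈ fineDom n Ωc →
      F.U (e₀ / n * Ac' x ν) = F.U (e₀ / n * (Ac x ν + σ x - σ (x + e1 ν)))) :
    regionOp F e₀ hn a m2 Ωc Ac'
      = blockDiag (fun u : ↥(fineDom n Ωc) => F.U (e₀ / n * σ u.1)) * regionOp F e₀ hn a m2 Ωc Ac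
          * (blockDiag fun u : ↥(fineDom n Ωc) => F.U (e₀ / n * σ u.1))ᵀ := by
  unfold regionOp
  rw [b4Op_congr_fieldLink F (e₀ / n) m2 (a * ((n : ℝ) ^ (d + 1))⁻¹) (c := regWt n (fineDom n Ωc))
      (q := rBlkWt n Ωc (fineDom n Ωc)) (emb := rbaseEmb hn Ωc) (Γ := rstairContour hn Ωc)
      (r := fun u v : ↥(fineDom n Ωc) => v.1 ∈ nbrs u.1) (fun x y hxy => regWt_ne_zero hxy)
      (fun y x => pathRel_mono (fun u v huv => huv.1) _ _ (rstairContour_path hn Ωc y x))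
      (fieldLink_compField_eq_bondGauge F (e₀ / n) hlink),
    b4Op_bondGauge F (e₀ / n) (regWt n (fineDom n Ωc)) m2 (a * ((n : ℝ) ^ (d + 1))⁻¹)
      (q := rBlkWt n Ωc (fineDom n Ωc)) (emb := rbaseEmb hn Ωc) (Γ := rstairContour hn Ωc)
      (fun y x h => rstairContour_end hn Ωc y x h)]

/-- **LOCALITY IN THE `U(1)`/`SO(N)` BOND VARIABLES**: two component fields with the same link variables on the bonds of `Ω` give the same
region operator. [cite: Balaban1983RegularityDecay, (1.3)–(1.6) p.572] -/
theorem regionOp_congr_link [Fintype ι] [DecidableEq ι] (F : OrthFlow ι) (e₀ : ℝ) {n : ℕ} (hn : 1 ≤ n) (a m2 : ℝ)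
    (Ωc : Finset (Fin (d + 1) → ℤ))
    {Ac Ac' : (Fin (d + 1) → ℤ) → Fin (d + 1) → ℝ}
    (hlink : ∀ x ∈ fineDom n Ωc, ∀ ν : Fin (d + 1), x + e1 ν ∈ fineDom n Ωc → F.U (e₀ / n * Ac' x ν) = F.U (e₀ / n * Ac x ν)) :
    regionOp F e₀ hn a m2 Ωc Ac' = regionOp F e₀ hn a m2 Ωc Ac := by
  have h := regionOp_gauge F e₀ hn a m2 Ωc (Ac := Ac) (Ac' := Ac') (σ := fun _ => 0)
    (fun x hx ν hν => by simpa only [add_zero, sub_zero] using hlink x hx ν hν)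
  simpa only [mul_zero, F.map_zero, blockDiag_one, Matrix.one_mul, Matrix.transpose_one, Matrix.mul_one] using h

end Region

/-! ## §3  Logarithm independence: [7]'s operator at a `U(1)` background on the torus is a function of the background alone -/

section LogField

variable {P : Params} {d : ℕ}

/-- **`H(Ω, u)` IS WELL DEFINED**: for a `U(1)` field `u` on the η-torus (`P.d = d + 1`, [7]'s coordinates `x ∈ ℤ^{d+1}` charted by the
periodic projection `castSite`), any two real component fields `A'`, `A''` with `e^{i(e/n)A'_ν(x)} = u(⟨x, ν⟩) = e^{i(e/n)A''_ν(x)}` on the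
bonds of `Ω` (both ends in `Ω`) give THE SAME [7]-operator `regionOp rot e Ω ·` — the operator `−Δ^{η,N}_{u,Ω} + m² + a_kP_k(u)` of the
background `u`. [cite: Balaban1983RegularityDecay, (1.2)–(1.6) p.572; BalabanImbrieJaffe1985, §7.3 p.326] -/
theorem regionOp_logField_eq (hPd : P.d = d + 1) (u : U1Field P 0) (e₀ : ℝ) {n : ℕ} (hn : 1 ≤ n) (a m2 : ℝ)
    (Ωc : Finset (Fin (d + 1) → ℤ)) {Ac' Ac'' : (Fin (d + 1) → ℤ) → Fin (d + 1) → ℝ}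
    (hlog' : ∀ x ∈ fineDom n Ωc, ∀ ν : Fin (d + 1), x + e1 ν ∈ fineDom n Ωc →
      Circle.exp (e₀ / n * Ac' x ν) = u ⟨castSite (fun j : Fin P.d => x (Fin.cast hPd j)), Fin.cast hPd.symm ν⟩)
    (hlog'' : ∀ x ∈ fineDom n Ωc, ∀ ν : Fin (d + 1), x + e1 ν ∈ fineDom n Ωc →
      Circle.exp (e₀ / n * Ac'' x ν) = u ⟨castSite (fun j : Fin P.d => x (Fin.cast hPd j)), Fin.cast hPd.symm ν⟩) :
    regionOp OrthFlow.rot e₀ hn a m2 Ωc Ac' = regionOp OrthFlow.rot e₀ hn a m2 Ωc Ac'' :=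
  regionOp_congr_link OrthFlow.rot e₀ hn a m2 Ωc fun x hx ν hν =>
    rot_U_eq_of_circleExp_eq (by rw [hlog' x hx ν hν, hlog'' x hx ν hν])

/-- **THE PRINCIPAL LOGARITHM IS A LOGARITHM FIELD**: `A'_ν(x) := (n/e)·arg u(⟨x, ν⟩)` satisfies `e^{i(e/n)A'_ν(x)} = u(⟨x, ν⟩)` on every bond
(`e ≠ 0`, `n ≥ 1`) — so the class of logarithm fields of `u` on `Ω` is never empty and `H(Ω, u) := regionOp rot e Ω ((n/e)·arg u)` is a
canonical representative. [cite: Balaban1983RegularityDecay, (1.2) p.572] -/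
theorem logField_arg (hPd : P.d = d + 1) (u : U1Field P 0) {e₀ : ℝ} (he : e₀ ≠ 0) {n : ℕ} (hn : 1 ≤ n)
    (x : Fin (d + 1) → ℤ) (ν : Fin (d + 1)) :
    Circle.exp (e₀ / n * ((n : ℝ) / e₀ *
        Complex.arg (u ⟨castSite (fun j : Fin P.d => x (Fin.cast hPd j)), Fin.cast hPd.symm ν⟩ : ℂ)))
      = u ⟨castSite (fun j : Fin P.d => x (Fin.cast hPd j)), Fin.cast hPd.symm ν⟩ := by
  have hn0 : (n : ℝ) ≠ 0 := by exact_mod_cast (Nat.one_le_iff_ne_zero.mp hn)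
  have h1 : e₀ / n * ((n : ℝ) / e₀) = 1 := by
    rw [div_mul_div_comm, div_eq_one_iff_eq (mul_ne_zero hn0 he), mul_comm]
  rw [← mul_assoc, h1, one_mul]
  exact Circle.exp_arg _

end LogField

/-! ## §4  Transfer of forms, inverses and sitewise sup bounds under orthogonal block-diagonal conjugation -/

section Transfer

variable {X ι : Type*}

/-- the form of a conjugate: `⟨Φ, 𝒢H𝒢ᵀΦ⟩ = ⟨𝒢ᵀΦ, H𝒢ᵀΦ⟩`. [folklore] -/
private theorem dotProduct_conj_mulVec [Fintype X] [Fintype ι] [DecidableEq X] (g : X → Matrix ι ι ℝ)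
    (H : Matrix (X × ι) (X × ι) ℝ) (Φ : X × ι → ℝ) :
    Φ ⬝ᵥ ((blockDiag g * H * (blockDiag g)ᵀ) *ᵥ Φ) = ((blockDiag g)ᵀ *ᵥ Φ) ⬝ᵥ (H *ᵥ ((blockDiag g)ᵀ *ᵥ Φ)) := by
  rw [← Matrix.mulVec_mulVec, ← Matrix.mulVec_mulVec, Matrix.dotProduct_mulVec, Matrix.mulVec_transpose]

/-- an orthogonal block-diagonal operator preserves the `ℓ²` norm: `|𝒢ᵀΦ|² = |Φ|²`. [folklore] -/
private theorem dotProduct_blockDiagT_self [Fintype X] [Fintype ι] [DecidableEq X] [DecidableEq ι]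
    {g : X → Matrix ι ι ℝ} (hg : IsGauge g) (Φ : X × ι → ℝ) :
    ((blockDiag g)ᵀ *ᵥ Φ) ⬝ᵥ ((blockDiag g)ᵀ *ᵥ Φ) = Φ ⬝ᵥ Φ := by
  have h := dotProduct_conj_mulVec g 1 Φ
  rw [Matrix.mul_one, blockDiag_mul_transpose_self hg, Matrix.one_mulVec, Matrix.one_mulVec] at h
  exact h.symm

/-- lower bounds of forms are invariant under orthogonal block-diagonal conjugation: `H ≥ γ` ⇒ `𝒢H𝒢ᵀ ≥ γ` (the mechanism of [7]'s
*"we reduce them to the case A₀ = 0"* for (1.8)). [folklore] -/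
private theorem form_conj_ge [Fintype X] [Fintype ι] [DecidableEq X] [DecidableEq ι] {g : X → Matrix ι ι ℝ} (hg : IsGauge g)
    {H : Matrix (X × ι) (X × ι) ℝ} {γ : ℝ}
    (hH : ∀ Φ : X × ι → ℝ, γ * (Φ ⬝ᵥ Φ) ≤ Φ ⬝ᵥ (H *ᵥ Φ)) (Φ : X × ι → ℝ) :
    γ * (Φ ⬝ᵥ Φ) ≤ Φ ⬝ᵥ ((blockDiag g * H * (blockDiag g)ᵀ) *ᵥ Φ) := by
  rw [dotProduct_conj_mulVec, ← dotProduct_blockDiagT_self hg Φ]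
  exact hH _

/-- a component of `𝒢Ψ` at a site is a combination of the components of `Ψ` there with coefficients of modulus `≤ 1`:
`|(𝒢Ψ)(x)_i| ≤ Σ_j |Ψ(x)_j|`. [folklore] -/
private theorem abs_blockDiag_mulVec_apply_le [Fintype X] [Fintype ι] [DecidableEq X] {g : X → Matrix ι ι ℝ}
    (hg : ∀ x i j, |g x i j| ≤ 1) (Ψ : X × ι → ℝ) (x : X) (i : ι) : |(blockDiag g *ᵥ Ψ) (x, i)| ≤ ∑ j, |Ψ (x, j)| := by
  have h : (blockDiag g *ᵥ Ψ) (x, i) = ∑ j, g x i j * Ψ (x, j) := by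
    have := congrFun (fld_blockDiag_mulVec g Ψ x) i
    simpa [fld, Matrix.mulVec, dotProduct] using this
  rw [h]
  refine (Finset.abs_sum_le_sum_abs _ _).trans (Finset.sum_le_sum fun j _ => ?_)
  rw [abs_mul]
  exact mul_le_of_le_one_left (abs_nonneg _) (hg x i j)

/-- entries of the blocks of a gauge transformation and of their transposes are bounded by `1`. [folklore] -/
private theorem isGauge_abs_apply_le_one [Fintype ι] [DecidableEq ι] {g : X → Matrix ι ι ℝ} (hg : IsGauge g) (x : X)
    (i j : ι) :
    |g x i j| ≤ 1 ∧ |(g x)ᵀ i j| ≤ 1 := by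
  refine ⟨abs_apply_le_one_of_orthogonal (hg x) i j, abs_apply_le_one_of_orthogonal ?_ i j⟩
  rw [Matrix.transpose_transpose]
  exact hg.mul_transpose x

/-- **SITEWISE SUP BOUNDS TRANSFER UNDER CONJUGATION**: if every colour component of `G(𝒢ᵀf)` at the site `x` is `≤ B` in modulus, then
every colour component of `(𝒢G𝒢ᵀ)f` at `x` is `≤ N·B`. [folklore] -/
private theorem abs_conj_mulVec_apply_le [Fintype X] [Fintype ι] [DecidableEq X] [DecidableEq ι] {g : X → Matrix ι ι ℝ}
    (hg : IsGauge g) (G : Matrix (X × ι) (X × ι) ℝ) (f : X × ι → ℝ) (x : X) {B : ℝ}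
    (hB : ∀ j, |(G *ᵥ ((blockDiag g)ᵀ *ᵥ f)) (x, j)| ≤ B) (i : ι) :
    |((blockDiag g * G * (blockDiag g)ᵀ) *ᵥ f) (x, i)| ≤ Fintype.card ι * B := by
  rw [← Matrix.mulVec_mulVec, ← Matrix.mulVec_mulVec]
  refine (abs_blockDiag_mulVec_apply_le (fun x i j => (isGauge_abs_apply_le_one hg x i j).1) _ x i).trans ?_
  calc ∑ j, |(G *ᵥ ((blockDiag g)ᵀ *ᵥ f)) (x, j)| ≤ ∑ _j : ι, B := Finset.sum_le_sum fun j _ => hB j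
    _ = Fintype.card ι * B := by rw [Finset.sum_const, nsmul_eq_mul, Finset.card_univ]

/-- the sup norm of `𝒢ᵀf` is at most `N` times that of `f`. [folklore] -/
private theorem norm_blockDiagT_mulVec_le [Fintype X] [Fintype ι] [DecidableEq X] [DecidableEq ι] {g : X → Matrix ι ι ℝ}
    (hg : IsGauge g) (f : X × ι → ℝ) :
    ‖(blockDiag g)ᵀ *ᵥ f‖ ≤ Fintype.card ι * ‖f‖ := by
  refine (pi_norm_le_iff_of_nonneg (by positivity)).mpr fun p => ?_
  obtain ⟨x, i⟩ := p
  rw [Real.norm_eq_abs, blockDiag_transpose]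
  refine (abs_blockDiag_mulVec_apply_le (fun x i j => (isGauge_abs_apply_le_one hg x i j).2) f x i).trans ?_
  calc ∑ j, |f (x, j)| ≤ ∑ _j : ι, ‖f‖ := Finset.sum_le_sum fun j _ => by
          rw [← Real.norm_eq_abs]; exact norm_le_pi_norm f (x, j)
    _ = Fintype.card ι * ‖f‖ := by rw [Finset.sum_const, nsmul_eq_mul, Finset.card_univ]

/-- `𝒢ᵀ` acts sitewise, so it preserves supports in the site variable. [folklore] -/
private theorem blockDiagT_mulVec_eq_zero [Fintype X] [Fintype ι] [DecidableEq X] (g : X → Matrix ι ι ℝ) {f : X × ι → ℝ}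
    {S : X → Prop}
    (hf : ∀ p : X × ι, S p.1 → f p = 0) (p : X × ι) (hp : S p.1) : ((blockDiag g)ᵀ *ᵥ f) p = 0 := by
  obtain ⟨x, i⟩ := p
  have h : ((blockDiag fun x => (g x)ᵀ) *ᵥ f) (x, i) = ∑ j, (g x)ᵀ i j * f (x, j) := by
    have := congrFun (fld_blockDiag_mulVec (fun x => (g x)ᵀ) f x) i
    simpa [fld, Matrix.mulVec, dotProduct] using this
  rw [blockDiag_transpose, h]
  exact Finset.sum_eq_zero fun j _ => by rw [hf (x, j) hp, mul_zero]

end Transfer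

/-! ## §5  The actual background: every logarithm field of `u_k` on a region inside the box is a gauge transform of the smooth gauge -/

section Actual

variable {P : Params} {d : ℕ}

/-- transport of [7]'s unit vector under the chart: `(x + e_ν) ∘ cast = x ∘ cast + e_{cast ν}`. [folklore] -/
private theorem comp_cast_add_e1 (hPd : P.d = d + 1) (x : Fin (d + 1) → ℤ) (ν : Fin (d + 1)) :
    (fun j : Fin P.d => (x + e1 ν) (Fin.cast hPd j)) = (fun j : Fin P.d => x (Fin.cast hPd j)) + e (Fin.cast hPd.symm ν) := by
  funext j
  simp only [Pi.add_apply, e1, e, Pi.single_apply]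
  congr 1
  simp [Fin.ext_iff]

/-- the far end of the torus bond `⟨x, x + e_ν⟩` in the chart is the chart of `x + e_ν`. [folklore] -/
private theorem tgt_castSite (hPd : P.d = d + 1) (x : Fin (d + 1) → ℤ) (ν : Fin (d + 1)) :
    (⟨castSite (fun j : Fin P.d => x (Fin.cast hPd j)), Fin.cast hPd.symm ν⟩ : PBond P 0).tgt
      = castSite (fun j : Fin P.d => (x + e1 ν) (Fin.cast hPd j)) := by
  rw [comp_cast_add_e1 hPd x ν, castSite_add_e]
  rfl

/-- a bond `⟨x, x + e_ν⟩` of [7]'s lattice starting at a fine point of a region whose blocks sit in the box with one bond of slack is (the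
chart of) a box bond. [folklore] -/
private theorem castSite_mem_boxBonds (hPd : P.d = d + 1) {k : ℕ} {lo hi : Fin P.d → ℤ} {Ωc : Finset (Fin (d + 1) → ℤ)}
    (hΩ : ∀ y ∈ Ωc, ∀ i : Fin (d + 1),
      lo (Fin.cast hPd.symm i) ≤ (P.L : ℤ) ^ k * y i ∧ (P.L : ℤ) ^ k * y i + (P.L : ℤ) ^ k ≤ hi (Fin.cast hPd.symm i))
    {x : Fin (d + 1) → ℤ} (hx : x ∈ fineDom (P.L ^ k) Ωc) (ν : Fin (d + 1)) :
    (⟨castSite (fun j : Fin P.d => x (Fin.cast hPd j)), Fin.cast hPd.symm ν⟩ : PBond P 0) ∈ boxBonds lo hi := by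
  have hLk : 1 ≤ P.L ^ k := Nat.one_le_pow _ _ P.L_pos
  have hcast : ((P.L ^ k : ℕ) : ℤ) = (P.L : ℤ) ^ k := by push_cast; rfl
  have hy := (mem_fineDom hLk).mp hx
  have hjj : ∀ j : Fin P.d, Fin.cast hPd.symm (Fin.cast hPd j) = j := fun j => Fin.ext (by simp)
  refine ⟨fun j : Fin P.d => x (Fin.cast hPd j), fun j => ?_, fun j => ?_, rfl⟩
  · show lo j ≤ x (Fin.cast hPd j)
    have h1 := (hΩ _ hy (Fin.cast hPd j)).1
    rw [hjj] at h1
    have h2 := (blk_bounds hLk x (Fin.cast hPd j)).1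
    rw [hcast] at h2
    exact h1.trans h2
  · show x (Fin.cast hPd j) + e (Fin.cast hPd.symm ν) j ≤ hi j
    have h1 := (hΩ _ hy (Fin.cast hPd j)).2
    rw [hjj] at h1
    have h2 := (blk_bounds hLk x (Fin.cast hPd j)).2
    rw [hcast] at h2
    have h3 : e (Fin.cast hPd.symm ν) j ≤ (1 : ℤ) := by
      rw [e_apply]
      split_ifs <;> norm_num
    linarith

/-- **EVERY LOGARITHM FIELD OF `u = exp[ie(∂λ + ηA)]` ON `Ω ⊂ Λ` HAS THE LINK VARIABLES OF THE GAUGE TRANSFORM OF `A` BY `−L^kλ`**: if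
`u(b) = exp(ie((∂λ)(b) + ηA(b)))` on the box bonds and `e^{i(e/L^k)A'_ν(x)} = u(⟨x, ν⟩)` on the bonds of `Ω`, then
`R((e/L^k)A'_ν(x)) = R((e/L^k)(A_ν(x) + σ(x) − σ(x + e_ν)))` with `σ = −L^k·λ` and `A_ν(x) := A(⟨x, ν⟩)` (charted).
[cite: BalabanImbrieJaffe1985, §7.3 p.326 «by change of gauge u_k can be transformed … into … exp[ie_kηA]»] -/
theorem rot_link_of_logField (hPd : P.d = d + 1) {k : ℕ} {e₀ : ℝ} {u : U1Field P 0} {lo hi : Fin P.d → ℤ}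
    {Ωc : Finset (Fin (d + 1) → ℤ)}
    (hΩ : ∀ y ∈ Ωc, ∀ i : Fin (d + 1),
      lo (Fin.cast hPd.symm i) ≤ (P.L : ℤ) ^ k * y i ∧ (P.L : ℤ) ^ k * y i + (P.L : ℤ) ^ k ≤ hi (Fin.cast hPd.symm i))
    {lam : TSite P 0 → ℝ} {A : PBond P 0 → ℝ}
    (hform : ∀ b ∈ boxBonds lo hi, u b = Circle.exp (e₀ * (grad 1 lam b + P.eta k * A b)))
    {Ac' : (Fin (d + 1) → ℤ) → Fin (d + 1) → ℝ}
    (hlog : ∀ x ∈ fineDom (P.L ^ k) Ωc, ∀ ν : Fin (d + 1), x + e1 ν ∈ fineDom (P.L ^ k) Ωc →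
      Circle.exp (e₀ / ((P.L ^ k : ℕ) : ℝ) * Ac' x ν) = u ⟨castSite (fun j : Fin P.d => x (Fin.cast hPd j)), Fin.cast hPd.symm ν⟩) :
    ∀ x ∈ fineDom (P.L ^ k) Ωc, ∀ ν : Fin (d + 1), x + e1 ν ∈ fineDom (P.L ^ k) Ωc →
      OrthFlow.rot.U (e₀ / ((P.L ^ k : ℕ) : ℝ) * Ac' x ν)
        = OrthFlow.rot.U (e₀ / ((P.L ^ k : ℕ) : ℝ) *
            (A ⟨castSite (fun j : Fin P.d => x (Fin.cast hPd j)), Fin.cast hPd.symm ν⟩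
              + -(((P.L ^ k : ℕ) : ℝ) * lam (castSite (fun j : Fin P.d => x (Fin.cast hPd j))))
              - -(((P.L ^ k : ℕ) : ℝ) * lam (castSite (fun j : Fin P.d => (x + e1 ν) (Fin.cast hPd j)))))) := by
  intro x hx ν hν
  apply rot_U_eq_of_circleExp_eq
  rw [hlog x hx ν hν, hform _ (castSite_mem_boxBonds hPd hΩ hx ν)]
  congr 1
  have hn : ((P.L ^ k : ℕ) : ℝ) ≠ 0 := by
    have : 1 ≤ P.L ^ k := Nat.one_le_pow _ _ P.L_pos
    exact_mod_cast (Nat.one_le_iff_ne_zero.mp this)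
  have hη : P.eta k = (((P.L ^ k : ℕ) : ℝ))⁻¹ := by rw [eta_eq_inv_pow, Nat.cast_pow]
  simp only [grad, one_smul]
  rw [tgt_castSite hPd x ν, hη]
  field_simp [hn]
  ring

/-- **THE LOCAL SMOOTH GAUGE AND THE CONJUGATION, ALL TORI AND SCALES** — for every `d ≥ 1`, odd `L > 1`, `p`, box size `n`, `a`, `m²`,
`β < 1`, `c > 0` there is `e₁ > 0` such that on every torus (`P.d = d + 1`, `P.L = L`), every scale `1 ≤ k ≤ m + K`, every `0 < e ≤ e₁`,
every unit field `v` with (7.3.1) `|v(∂p) − 1| ≤ e(1 + log e⁻¹)^p`, every box `[lo, lo + n]` (`n < sitesPerDir 0`) and every finite set `Ω` of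
unit labels whose blocks sit in the box with one bond of slack, there are `λ`, `A` with: `u_k = exp[ie(∂λ + ηA)]` on the box bonds (files
1–2), `A` regular on `Ω` in the sense of (1.7) (file 3), AND FOR EVERY LOGARITHM FIELD `A'` OF `u_k` ON `Ω` (`e^{i(e/L^k)A'_ν(x)} = u_k(⟨x, ν⟩)`
whenever `x, x + e_ν ∈ Ω`): **`regionOp rot e Ω A' = 𝒢_λ · regionOp rot e Ω A · 𝒢_λᵀ`**, `𝒢_λ = ⊕_x R(−eλ(x))` — [7]'s operator at the
background `u_k` is the gauge conjugate of [7]'s operator at the smooth small `A`.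
[cite: BalabanImbrieJaffe1985, §7.3 p.326; Balaban1983RegularityDecay, (1.6) p.572, pp.580–581] -/
theorem regionOp_actualBg_conj_allTori {d L : ℕ} (hd : 1 ≤ d) (hL : Odd L ∧ 1 < L) (pexp : ℝ) (n : ℕ) {β c : ℝ} (hβ : β < 1)
    (hc : 0 < c) :
    ∃ e₁ : ℝ, 0 < e₁ ∧ ∀ (P : Params) (hPd : P.d = d + 1), P.L = L → ∀ (k : ℕ), 1 ≤ k → ∀ (hk : k ≤ P.m + P.K)
      (e₀ : ℝ), 0 < e₀ → e₀ ≤ e₁ →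
      ∀ (v : U1Field P k), (∀ p : TPlaq P k, ‖((plaq v p : Circle) : ℂ) - 1‖ ≤ e₀ * (1 + Real.log e₀⁻¹) ^ pexp) →
      ∀ (lo hi : Fin P.d → ℤ), (∀ κ, hi κ ≤ lo κ + n) → n < P.sitesPerDir 0 →
      ∀ (Ωc : Finset (Fin (d + 1) → ℤ)), (∀ y ∈ Ωc, ∀ i : Fin (d + 1),
        lo (Fin.cast hPd.symm i) ≤ (P.L : ℤ) ^ k * y i ∧ (P.L : ℤ) ^ k * y i + (P.L : ℤ) ^ k ≤ hi (Fin.cast hPd.symm i)) →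
      ∃ (lam : TSite P 0 → ℝ) (A : PBond P 0 → ℝ),
        (∀ b ∈ boxBonds lo hi, actualBg ((Nat.succ_le_succ hd).trans_eq hPd.symm) k e₀ v b =
          Circle.exp (e₀ * (grad 1 lam b + P.eta k * A b))) ∧
        (∀ x ∈ fineDom (P.L ^ k) Ωc, ∀ μ ν : Fin (d + 1),
          |A ⟨castSite (fun j : Fin P.d => (x + e1 μ) (Fin.cast hPd j)), Fin.cast hPd.symm ν⟩ -
              A ⟨castSite (fun j : Fin P.d => x (Fin.cast hPd j)), Fin.cast hPd.symm ν⟩| ≤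
            c * e₀ ^ (β - 1) / ((P.L ^ k : ℕ) : ℝ)) ∧
        ∀ (Ac' : (Fin (d + 1) → ℤ) → Fin (d + 1) → ℝ),
          (∀ x ∈ fineDom (P.L ^ k) Ωc, ∀ ν : Fin (d + 1), x + e1 ν ∈ fineDom (P.L ^ k) Ωc →
            Circle.exp (e₀ / ((P.L ^ k : ℕ) : ℝ) * Ac' x ν) =
              actualBg ((Nat.succ_le_succ hd).trans_eq hPd.symm) k e₀ v
                ⟨castSite (fun j : Fin P.d => x (Fin.cast hPd j)), Fin.cast hPd.symm ν⟩) →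
          ∀ (hn : 1 ≤ P.L ^ k) (a m2 : ℝ),
            regionOp OrthFlow.rot e₀ hn a m2 Ωc Ac'
              = blockDiag (fun x : ↥(fineDom (P.L ^ k) Ωc) =>
                    OrthFlow.rot.U (-(e₀ * lam (castSite (fun j : Fin P.d => x.1 (Fin.cast hPd j))))))
                * regionOp OrthFlow.rot e₀ hn a m2 Ωc
                    (fun x ν => A ⟨castSite (fun j : Fin P.d => x (Fin.cast hPd j)), Fin.cast hPd.symm ν⟩)
                * (blockDiag fun x : ↥(fineDom (P.L ^ k) Ωc) =>
                    OrthFlow.rot.U (-(e₀ * lam (castSite (fun j : Fin P.d => x.1 (Fin.cast hPd j))))))ᵀ := by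
  obtain ⟨e₁, he₁, hall⟩ := exists_regular17_gauge_allTori (Nat.succ_le_succ hd) hL pexp n hβ hc
  refine ⟨e₁, he₁, fun P hPd hPL k hk1 hk e₀ he hle v hv lo hi hbox hnN Ωc hΩ => ?_⟩
  obtain ⟨lam, A, hform, -, hgradA⟩ := hall P hPd hPL k hk1 hk e₀ he hle v hv lo hi hbox hnN
  refine ⟨lam, A, hform, regular17_fineDom_of_box hPd hgradA Ωc hΩ, fun Ac' hlog hn a m2 => ?_⟩
  have hlink := rot_link_of_logField hPd hΩ hform hlog
  have hn0 : ((P.L ^ k : ℕ) : ℝ) ≠ 0 := by exact_mod_cast (Nat.one_le_iff_ne_zero.mp hn)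
  have hG : (fun x : ↥(fineDom (P.L ^ k) Ωc) =>
        OrthFlow.rot.U (-(e₀ * lam (castSite (fun j : Fin P.d => x.1 (Fin.cast hPd j))))))
      = fun x : ↥(fineDom (P.L ^ k) Ωc) => OrthFlow.rot.U (e₀ / ((P.L ^ k : ℕ) : ℝ) *
          -(((P.L ^ k : ℕ) : ℝ) * lam (castSite (fun j : Fin P.d => x.1 (Fin.cast hPd j))))) := by
    funext x
    congr 1
    rw [mul_neg, ← mul_assoc, div_mul_cancel₀ _ hn0]
  rw [hG]
  exact regionOp_gauge OrthFlow.rot e₀ hn a m2 Ωc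
    (Ac := fun x ν => A ⟨castSite (fun j : Fin P.d => x (Fin.cast hPd j)), Fin.cast hPd.symm ν⟩)
    (σ := fun x => -(((P.L ^ k : ℕ) : ℝ) * lam (castSite (fun j : Fin P.d => x (Fin.cast hPd j))))) hlink

end Actual

/-! ## §6  (1.8) of [7] for the region operators at the actual background, every logarithm field -/

section Claim18

variable {d : ℕ}

/-- **(1.8) OF [7] HOLDS FOR [7]'s OPERATOR AT THE ACTUAL BACKGROUND `u_k` ON EVERY REGION INSIDE A LOCAL BOX, FOR EVERY LOGARITHM FIELD,
ALL TORI AND SCALES** — rotation flow (`N = 2`), every `a > 0`, `0 < β < 1`, `c > 0`, `p`, box size `n`: there are `γ₀ > 0` and `e₁ > 0`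
(INDEPENDENT of the torus, the scale, `Ω`, the field and the logarithm chosen) such that under (7.3.1) with `0 < e ≤ e₁`, for every
non-wrapping box, every finite set `Ω` of unit labels whose blocks sit in the box with one bond of slack and EVERY real component field `A'`
with `e^{i(e/L^k)A'_ν(x)} = u_k(⟨x, ν⟩)` on the bonds of `Ω`: r01's `lower18 γ₀` holds for the instance `⟨L^k, Ω, e, A'⟩`, i.e.
`−Δ^{η,N}_{u_k,Ω} + a_kP_k(u_k) ≥ γ₀I` — *"The constant γ₀ is independent of the lattice spacing η, as well as of Ω and of A."*  (`A'`
itself is in general NOT regular: (1.8) transfers from the smooth gauge by §4–§5.)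
[cite: BalabanImbrieJaffe1985, §7.3 p.326; Balaban1983RegularityDecay, (1.8) p.573] -/
theorem claim18_region_actualBg_allTori {d L : ℕ} (hd : 1 ≤ d) (hL : Odd L ∧ 1 < L) (pexp : ℝ) (n : ℕ) {a β c : ℝ}
    (ha : 0 < a) (hβ0 : 0 < β) (hβ1 : β < 1) (hc : 0 < c) :
    ∃ γ₀ e₁ : ℝ, 0 < γ₀ ∧ 0 < e₁ ∧ ∀ (P : Params) (hPd : P.d = d + 1), P.L = L → ∀ (k : ℕ), 1 ≤ k → ∀ (hk : k ≤ P.m + P.K)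
      (e₀ : ℝ), 0 < e₀ → e₀ ≤ e₁ →
      ∀ (v : U1Field P k), (∀ p : TPlaq P k, ‖((plaq v p : Circle) : ℂ) - 1‖ ≤ e₀ * (1 + Real.log e₀⁻¹) ^ pexp) →
      ∀ (lo hi : Fin P.d → ℤ), (∀ κ, hi κ ≤ lo κ + n) → n < P.sitesPerDir 0 →
      ∀ (Ωc : Finset (Fin (d + 1) → ℤ)), (∀ y ∈ Ωc, ∀ i : Fin (d + 1),
        lo (Fin.cast hPd.symm i) ≤ (P.L : ℤ) ^ k * y i ∧ (P.L : ℤ) ^ k * y i + (P.L : ℤ) ^ k ≤ hi (Fin.cast hPd.symm i)) →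
      ∀ (Ac' : (Fin (d + 1) → ℤ) → Fin (d + 1) → ℝ),
        (∀ x ∈ fineDom (P.L ^ k) Ωc, ∀ ν : Fin (d + 1), x + e1 ν ∈ fineDom (P.L ^ k) Ωc →
          Circle.exp (e₀ / ((P.L ^ k : ℕ) : ℝ) * Ac' x ν) =
            actualBg ((Nat.succ_le_succ hd).trans_eq hPd.symm) k e₀ v
              ⟨castSite (fun j : Fin P.d => x (Fin.cast hPd j)), Fin.cast hPd.symm ν⟩) →
        (regularRegionSetting OrthFlow.rot a c β ⟨P.L ^ k, Nat.one_le_pow _ _ P.L_pos, Ωc, e₀, Ac'⟩).lower18 γ₀ := by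
  obtain ⟨γ₀, e₁', hγ₀, he₁', hfam⟩ := claim18Printed_regularRegion_rot (d := d) ha hc.le hβ0
  obtain ⟨e₁, he₁, hall⟩ := regionOp_actualBg_conj_allTori hd hL pexp n hβ1 hc
  refine ⟨γ₀, min e₁ e₁', hγ₀, lt_min he₁ he₁', fun P hPd hPL k hk1 hk e₀ he hle v hv lo hi hbox hnN Ωc hΩ Ac' hlog => ?_⟩
  obtain ⟨lam, A, -, hreg, hconj⟩ := hall P hPd hPL k hk1 hk e₀ he (hle.trans (min_le_left _ _)) v hv lo hi hbox hnN Ωc hΩ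
  -- (1.8) at the smooth gauge (r01's family theorem), then conjugate
  have hlow := hfam ⟨P.L ^ k, Nat.one_le_pow _ _ P.L_pos, Ωc, e₀,
    fun x ν => A ⟨castSite (fun j : Fin P.d => x (Fin.cast hPd j)), Fin.cast hPd.symm ν⟩⟩ hreg he (hle.trans (min_le_right _ _))
  rw [regularRegionSetting_lower18_iff] at hlow ⊢
  intro Φ
  have h := form_conj_ge (OrthFlow.rot.isGauge fun x : ↥(fineDom (P.L ^ k) Ωc) =>
    -(e₀ * lam (castSite (fun j : Fin P.d => x.1 (Fin.cast hPd j))))) hlow Φ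
  have hop := hconj Ac' hlog (Nat.one_le_pow _ _ P.L_pos) a 0
  unfold regionOp at hop
  rw [hop]
  exact h

/-- **… IN PARTICULAR FOR THE CANONICAL OPERATOR `H(Ω, u_k)` AT THE PRINCIPAL LOGARITHM `(L^k/e)·arg u_k`** — a statement about `u_k`
alone, no gauge chosen. [cite: BalabanImbrieJaffe1985, §7.3 p.326; Balaban1983RegularityDecay, (1.8) p.573] -/
theorem claim18_region_actualBg_arg_allTori {d L : ℕ} (hd : 1 ≤ d) (hL : Odd L ∧ 1 < L) (pexp : ℝ) (n : ℕ) {a β c : ℝ}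
    (ha : 0 < a) (hβ0 : 0 < β) (hβ1 : β < 1) (hc : 0 < c) :
    ∃ γ₀ e₁ : ℝ, 0 < γ₀ ∧ 0 < e₁ ∧ ∀ (P : Params) (hPd : P.d = d + 1), P.L = L → ∀ (k : ℕ), 1 ≤ k → ∀ (hk : k ≤ P.m + P.K)
      (e₀ : ℝ), 0 < e₀ → e₀ ≤ e₁ →
      ∀ (v : U1Field P k), (∀ p : TPlaq P k, ‖((plaq v p : Circle) : ℂ) - 1‖ ≤ e₀ * (1 + Real.log e₀⁻¹) ^ pexp) →
      ∀ (lo hi : Fin P.d → ℤ), (∀ κ, hi κ ≤ lo κ + n) → n < P.sitesPerDir 0 →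
      ∀ (Ωc : Finset (Fin (d + 1) → ℤ)), (∀ y ∈ Ωc, ∀ i : Fin (d + 1),
        lo (Fin.cast hPd.symm i) ≤ (P.L : ℤ) ^ k * y i ∧ (P.L : ℤ) ^ k * y i + (P.L : ℤ) ^ k ≤ hi (Fin.cast hPd.symm i)) →
        (regularRegionSetting OrthFlow.rot a c β ⟨P.L ^ k, Nat.one_le_pow _ _ P.L_pos, Ωc, e₀,
          fun x ν => ((P.L ^ k : ℕ) : ℝ) / e₀ *
            Complex.arg (actualBg ((Nat.succ_le_succ hd).trans_eq hPd.symm) k e₀ v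
              ⟨castSite (fun j : Fin P.d => x (Fin.cast hPd j)), Fin.cast hPd.symm ν⟩ : ℂ)⟩).lower18 γ₀ := by
  obtain ⟨γ₀, e₁, hγ₀, he₁, hall⟩ := claim18_region_actualBg_allTori hd hL pexp n ha hβ0 hβ1 hc
  refine ⟨γ₀, e₁, hγ₀, he₁, fun P hPd hPL k hk1 hk e₀ he hle v hv lo hi hbox hnN Ωc hΩ => ?_⟩
  exact hall P hPd hPL k hk1 hk e₀ he hle v hv lo hi hbox hnN Ωc hΩ _
    fun x _ ν _ => logField_arg hPd _ he.ne' (Nat.one_le_pow _ _ P.L_pos) x ν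

end Claim18

/-! ## §7  The value member of (1.10) for `G_k(Ω, u_k)`, every logarithm field -/

section Thm110

variable {d : ℕ}

/-- **THE DECAY ESTIMATE (1.10) OF [7] (VALUE MEMBER) FOR `G_k(Ω, u_k)`, [7]'s GREEN'S FUNCTION AT THE ACTUAL BACKGROUND ON REGIONS INSIDE
A LOCAL BOX, FOR EVERY LOGARITHM FIELD, ALL TORI AND SCALES** — *"The propagators … also satisfy the regularity and decay estimates of
[7]"*: in r01's hypothesis-free typed shape `B4Thm110RegionLp.thm110_value_region_unitBlock` (`L = ℓ + 1`; windows `a ∈ [a₋, a₊]`,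
`0 ≤ m² ≤ m₊²`; cube size `K₀`, `8 ∣ K₀`; `δ₀ = 1/K₀` per η-unit; `R₀ = K₀(d + 3)` unit labels; `f` supported in one unit block at
`ℓ^∞`-distance `≥ D`) there are `K₀`, `c₀ > 0` and, for every `c > 0`, `0 < β < 1`, an `e₁ > 0` such that on every torus (`P.d = d + 1`,
`P.L = ℓ + 1`), every scale, every `0 < e ≤ e₁`, every unit field `v` with (7.3.1), every box `[lo, lo + n]`, every union `Ω` of `K₀`-blocks
whose unit blocks sit in the box with one bond of slack, and EVERY real component field `A'` with `e^{i(e/L^k)A'_ν(x)} = u_k(⟨x, ν⟩)` on the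
bonds of `Ω`: `|(G_k(Ω, u_k)f)(x)_i| ≤ c₀·e^{−D/(L^kK₀)}·‖f‖_∞` for `G_k(Ω, u_k) = (regionOp rot e Ω A')⁻¹` (file 3's composition at the
smooth gauge, conjugated by `𝒢_λ`; `c₀` = 4 × r01's).  See HONEST SCOPE (i) for what `G_k(Ω, u_k)` is and is not.
[cite: BalabanImbrieJaffe1985, §7.3 p.326; Balaban1983RegularityDecay, Theorem (1.10) p.573] -/
theorem thm110_value_region_actualBg_allTori {d ℓ : ℕ} (hd : 1 ≤ d) (hℓ : 1 ≤ ℓ) (hodd : Odd (ℓ + 1)) (pexp : ℝ) (n : ℕ)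
    (amin aplus m2plus : ℝ) (ha : 0 < amin) :
    ∃ K₀ : ℕ, 8 ≤ K₀ ∧ 8 ∣ K₀ ∧ ∃ c₀ : ℝ, 0 < c₀ ∧ ∀ (c β : ℝ), 0 < c → 0 < β → β < 1 →
      ∃ e₁ : ℝ, 0 < e₁ ∧ ∀ (P : Params) (hPd : P.d = d + 1), P.L = ℓ + 1 → ∀ (k : ℕ), 1 ≤ k → ∀ (hk : k ≤ P.m + P.K)
      (e₀ : ℝ), 0 < e₀ → e₀ ≤ e₁ →
      ∀ (v : U1Field P k), (∀ p : TPlaq P k, ‖((plaq v p : Circle) : ℂ) - 1‖ ≤ e₀ * (1 + Real.log e₀⁻¹) ^ pexp) →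
      ∀ (lo hi : Fin P.d → ℤ), (∀ κ, hi κ ≤ lo κ + n) → n < P.sitesPerDir 0 →
      ∀ (Ωc : Finset (Fin (d + 1) → ℤ)), IsBlockUnion K₀ Ωc → (∀ y ∈ Ωc, ∀ i : Fin (d + 1),
        lo (Fin.cast hPd.symm i) ≤ (P.L : ℤ) ^ k * y i ∧ (P.L : ℤ) ^ k * y i + (P.L : ℤ) ^ k ≤ hi (Fin.cast hPd.symm i)) →
      ∀ (Ac' : (Fin (d + 1) → ℤ) → Fin (d + 1) → ℝ),
        (∀ x ∈ fineDom (P.L ^ k) Ωc, ∀ ν : Fin (d + 1), x + e1 ν ∈ fineDom (P.L ^ k) Ωc →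
          Circle.exp (e₀ / ((P.L ^ k : ℕ) : ℝ) * Ac' x ν) =
            actualBg ((Nat.succ_le_succ hd).trans_eq hPd.symm) k e₀ v
              ⟨castSite (fun j : Fin P.d => x (Fin.cast hPd j)), Fin.cast hPd.symm ν⟩) →
        ∀ (hn : 1 ≤ (ℓ + 1) ^ k) (a m2 : ℝ), amin ≤ a → a ≤ aplus → 0 ≤ m2 → m2 ≤ m2plus →
        ∀ (x : ↥(fineDom ((ℓ + 1) ^ k) Ωc)),
          (∀ y : Fin (d + 1) → ℤ, (∀ μ, |y μ - blk ((ℓ + 1) ^ k) x.1 μ| ≤ (K₀ : ℤ) * (d + 3)) → y ∈ Ωc) →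
        ∀ (y₀ : Fin (d + 1) → ℤ) (D : ℝ),
          (∀ x' : ↥(fineDom ((ℓ + 1) ^ k) Ωc), blk ((ℓ + 1) ^ k) x'.1 = y₀ →
            ∃ μ, D ≤ |rpos ((ℓ + 1) ^ k) Ωc x μ - rpos ((ℓ + 1) ^ k) Ωc x' μ|) →
        ∀ (f : ↥(fineDom ((ℓ + 1) ^ k) Ωc) × Fin 2 → ℝ), (∀ p, blk ((ℓ + 1) ^ k) p.1.1 ≠ y₀ → f p = 0) →
        ∀ i : Fin 2,
          |((regionOp OrthFlow.rot e₀ hn (B1.aSeq a ((ℓ : ℝ) + 1) k) m2 Ωc Ac')⁻¹ *ᵥ f) (x, i)|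
            ≤ c₀ * Real.exp (-(D / ((((ℓ + 1) ^ k : ℕ) : ℝ) * K₀))) * ‖f‖ := by
  obtain ⟨K₀, hK8, h8, c₀, hc₀, H⟩ := thm110_value_local_smooth_gauge_allTori hd hℓ hodd pexp n amin aplus m2plus ha
  refine ⟨K₀, hK8, h8, 4 * c₀, by positivity, fun c β hc hβ0 hβ1 => ?_⟩
  obtain ⟨e₁, he₁, H'⟩ := H c β hc hβ0 hβ1
  refine ⟨e₁, he₁, fun P hPd hPL k hk1 hk e₀ he hle v hv lo hi hbox hnN Ωc hBU hΩ Ac' hlog hn a m2 ha1 ha2 hm1 hm2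
    x hR y₀ D hD f hf i => ?_⟩
  -- file 3's (1.10) at its smooth gauge `A`, with the representation `u_k = exp[ie(∂λ + ηA)]` on the box bonds
  obtain ⟨lam, A, hform, hval⟩ := H' P hPd hPL k hk1 hk e₀ he hle v hv lo hi hbox hnN Ωc hBU hΩ
  have hPLk : P.L ^ k = (ℓ + 1) ^ k := by rw [hPL]
  rw [hPLk] at hlog
  have hN0 : (((ℓ + 1) ^ k : ℕ) : ℝ) ≠ 0 := by exact_mod_cast (pow_pos (Nat.succ_pos ℓ) k).ne'
  have hη : P.eta k = ((((ℓ + 1) ^ k : ℕ) : ℝ))⁻¹ := by rw [eta_eq_inv_pow, hPL, Nat.cast_pow]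
  -- the logarithm field `L^k(∂λ) + A` (charted) of that representation, written as the gauge transform of `A` by `σ = −L^kλ`
  set Ac₃ : (Fin (d + 1) → ℤ) → Fin (d + 1) → ℝ := fun x ν =>
    A ⟨castSite (fun j : Fin P.d => x (Fin.cast hPd j)), Fin.cast hPd.symm ν⟩
      + -((((ℓ + 1) ^ k : ℕ) : ℝ) * lam (castSite (fun j : Fin P.d => x (Fin.cast hPd j))))
      - -((((ℓ + 1) ^ k : ℕ) : ℝ) * lam (castSite (fun j : Fin P.d => (x + e1 ν) (Fin.cast hPd j)))) with hAc₃
  have hlog₃ : ∀ x ∈ fineDom ((ℓ + 1) ^ k) Ωc, ∀ ν : Fin (d + 1), x + e1 ν ∈ fineDom ((ℓ + 1) ^ k) Ωc →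
      Circle.exp (e₀ / (((ℓ + 1) ^ k : ℕ) : ℝ) * Ac₃ x ν) =
        actualBg ((Nat.succ_le_succ hd).trans_eq hPd.symm) k e₀ v
          ⟨castSite (fun j : Fin P.d => x (Fin.cast hPd j)), Fin.cast hPd.symm ν⟩ := by
    intro x hx ν _
    rw [hform _ (castSite_mem_boxBonds hPd hΩ (hPLk ▸ hx) ν)]
    congr 1
    simp only [hAc₃, grad, one_smul]
    rw [tgt_castSite hPd x ν, hη]
    field_simp [hN0]
    ring
  have hlink₃ : ∀ x ∈ fineDom ((ℓ + 1) ^ k) Ωc, ∀ ν : Fin (d + 1), x + e1 ν ∈ fineDom ((ℓ + 1) ^ k) Ωc →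
      OrthFlow.rot.U (e₀ / (((ℓ + 1) ^ k : ℕ) : ℝ) * Ac₃ x ν) = OrthFlow.rot.U (e₀ / (((ℓ + 1) ^ k : ℕ) : ℝ) *
        (A ⟨castSite (fun j : Fin P.d => x (Fin.cast hPd j)), Fin.cast hPd.symm ν⟩
          + -((((ℓ + 1) ^ k : ℕ) : ℝ) * lam (castSite (fun j : Fin P.d => x (Fin.cast hPd j))))
          - -((((ℓ + 1) ^ k : ℕ) : ℝ) * lam (castSite (fun j : Fin P.d => (x + e1 ν) (Fin.cast hPd j)))))) := by
    intro x _ ν _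
    simp only [hAc₃]
  -- both `Ac'` and `Ac₃` are logarithm fields of `u_k` on `Ω`: the same operator (§3) …
  have heq : regionOp OrthFlow.rot e₀ hn (B1.aSeq a ((ℓ : ℝ) + 1) k) m2 Ωc Ac'
      = regionOp OrthFlow.rot e₀ hn (B1.aSeq a ((ℓ : ℝ) + 1) k) m2 Ωc Ac₃ :=
    regionOp_logField_eq hPd _ e₀ hn (B1.aSeq a ((ℓ : ℝ) + 1) k) m2 Ωc hlog hlog₃
  -- … which is the gauge conjugate of file 3's operator at `A` (§2)
  have hop : regionOp OrthFlow.rot e₀ hn (B1.aSeq a ((ℓ : ℝ) + 1) k) m2 Ωc Ac₃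
      = blockDiag (fun x : ↥(fineDom ((ℓ + 1) ^ k) Ωc) => OrthFlow.rot.U (e₀ / (((ℓ + 1) ^ k : ℕ) : ℝ) *
            -((((ℓ + 1) ^ k : ℕ) : ℝ) * lam (castSite (fun j : Fin P.d => x.1 (Fin.cast hPd j))))))
        * regionOp OrthFlow.rot e₀ hn (B1.aSeq a ((ℓ : ℝ) + 1) k) m2 Ωc
            (fun x ν => A ⟨castSite (fun j : Fin P.d => x (Fin.cast hPd j)), Fin.cast hPd.symm ν⟩)
        * (blockDiag fun x : ↥(fineDom ((ℓ + 1) ^ k) Ωc) => OrthFlow.rot.U (e₀ / (((ℓ + 1) ^ k : ℕ) : ℝ) *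
            -((((ℓ + 1) ^ k : ℕ) : ℝ) * lam (castSite (fun j : Fin P.d => x.1 (Fin.cast hPd j))))))ᵀ :=
    regionOp_gauge OrthFlow.rot e₀ hn (B1.aSeq a ((ℓ : ℝ) + 1) k) m2 Ωc
      (Ac := fun x ν => A ⟨castSite (fun j : Fin P.d => x (Fin.cast hPd j)), Fin.cast hPd.symm ν⟩)
      (σ := fun x => -((((ℓ + 1) ^ k : ℕ) : ℝ) * lam (castSite (fun j : Fin P.d => x (Fin.cast hPd j))))) hlink₃
  have hg : IsGauge (fun x : ↥(fineDom ((ℓ + 1) ^ k) Ωc) => OrthFlow.rot.U (e₀ / (((ℓ + 1) ^ k : ℕ) : ℝ) *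
      -((((ℓ + 1) ^ k : ℕ) : ℝ) * lam (castSite (fun j : Fin P.d => x.1 (Fin.cast hPd j)))))) :=
    OrthFlow.rot.isGauge _
  rw [heq, hop, conj_inv hg]
  -- the value clause at the smooth gauge for the rotated source `𝒢ᵀf` (still supported in the block `y₀`), every colour
  have hfT : ∀ p : ↥(fineDom ((ℓ + 1) ^ k) Ωc) × Fin 2, blk ((ℓ + 1) ^ k) p.1.1 ≠ y₀ →
      ((blockDiag fun x : ↥(fineDom ((ℓ + 1) ^ k) Ωc) => OrthFlow.rot.U (e₀ / (((ℓ + 1) ^ k : ℕ) : ℝ) *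
          -((((ℓ + 1) ^ k : ℕ) : ℝ) * lam (castSite (fun j : Fin P.d => x.1 (Fin.cast hPd j))))))ᵀ *ᵥ f) p = 0 :=
    fun p hp => blockDiagT_mulVec_eq_zero _
      (S := fun z : ↥(fineDom ((ℓ + 1) ^ k) Ωc) => blk ((ℓ + 1) ^ k) z.1 ≠ y₀) hf p hp
  have hB : ∀ j : Fin 2, |((regionOp OrthFlow.rot e₀ hn (B1.aSeq a ((ℓ : ℝ) + 1) k) m2 Ωc
        (fun x ν => A ⟨castSite (fun j : Fin P.d => x (Fin.cast hPd j)), Fin.cast hPd.symm ν⟩))⁻¹ *ᵥ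
          ((blockDiag fun x : ↥(fineDom ((ℓ + 1) ^ k) Ωc) => OrthFlow.rot.U (e₀ / (((ℓ + 1) ^ k : ℕ) : ℝ) *
            -((((ℓ + 1) ^ k : ℕ) : ℝ) * lam (castSite (fun j : Fin P.d => x.1 (Fin.cast hPd j))))))ᵀ *ᵥ f)) (x, j)|
        ≤ c₀ * Real.exp (-(D / ((((ℓ + 1) ^ k : ℕ) : ℝ) * K₀))) * (2 * ‖f‖) := by
    intro j
    refine (hval hn a m2 ha1 ha2 hm1 hm2 x hR y₀ D hD _ hfT j).trans ?_
    have h2 := norm_blockDiagT_mulVec_le hg f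
    simp only [Fintype.card_fin, Nat.cast_ofNat] at h2
    have h0 : 0 ≤ c₀ * Real.exp (-(D / ((((ℓ + 1) ^ k : ℕ) : ℝ) * K₀))) := by positivity
    exact mul_le_mul_of_nonneg_left h2 h0
  refine (abs_conj_mulVec_apply_le hg _ f x hB i).trans (le_of_eq ?_)
  simp only [Fintype.card_fin, Nat.cast_ofNat]
  ring

end Thm110

end

end Literature.MathematicalPhysics.QuantumFieldTheory.BalabanImbrieJaffe1984to88.BIJ85RegionPropagatorsActualBg
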